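import Summits.QuantumFields.BalabanUV.Beta.GAN24.GaugeReadLabelSums

/-!
# `BalabanUV.Beta.GAN24.GaugeReadLayerForm` — binder row G-an2-4 / (CONV-C), CT-W «WC-TL», (Q-R) «QR-LL» row (LAY), interface RULING R-gan24p1-g25-2 (2) «(LT-Δ):
# layer letters are handed over UNSUMMED in difference form»: **THE RESPONSE READ WITH THE UNION WEIGHT `∇1_{T-fine}` IN CANCELLED LAYER FORM** — `g` on the
# ENTERING layer of the fine union `U = ⋃_{y∈T} B(y)` minus `g` on its EXITING layer, direction by direction, the interior faces of §4b's block-by-block form cancelled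
# (G-an2-4 formalisation swarm, unit `b2b-balaban-gan24-formalise-leaf-06`, gen 44; sequel of `GaugeReadLabelSums` §4b).

NOT IN PRINT; OUR BOOKKEEPING ([folklore] finite-sum bookkeeping: a `Finset.sum_biUnion` reindexing of the label sum of block sums as ONE sum over the fine union — the blocks
of distinct labels are disjoint by `AveragingContours.blk_block` — followed by leaf-03 g58's `BlockDivergenceFlux.finsetSum_sub_shift_eq_layers` BY NAME).  HONEST FRAMING (cell
contract, verbatim): «discharging `BetaPertH` makes Bałaban's UV stability UNCONDITIONAL — a real constructive-QFT result; it is NOT the continuum limit and NOT the Clay problem.»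
HONEST DEPENDENCY (verbatim): «continuum YM on T⁴ ⇐ BetaPertH ∧ nine spine estimates (0/9 proved); BetaPertH ⇐ (D1) ∧ (D4) ∧ CAP+tail; G-an2-4 gates asym, D1 and NE2/3/4.»
No cited fact, no `def`, no `def … : Prop`, 0 sorry.
* §1 `sum_sum_box_eq_sum_biUnion` — `Σ_{y∈T} Σ_{v∈box} f (N•y + toSite v) = Σ_{u ∈ ⋃_{y∈T} (N•y + box)} f u` (any additive commutative monoid; the fine union as a `Finset.biUnion`).
* §2 **`sum_read_gaugeWt_eq_layers`** — `∑' x₂, Σ_κ g κ x₂ · ĝ_T κ x₂ = Σ_κ (Σ_{w ∈ (U − e_κ) ∖ U} g κ w − Σ_{u ∈ U ∖ (U − e_κ)} g κ u)`: the (LT-Δ) interface shape for the response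
  letter — ONE bounded family read on the two boundary layers of the super-block, nothing in the bulk.
* §3 `toSite_update_top`, `boxSum_sub_shift_eq_zero_of_periodic`, **`sum_read_gaugeWt_eq_zero_of_periodic`** — a profile `N`-PERIODIC along each direction has ZERO
  response read against `ĝ_T`, for EVERY `T` (the exiting face of a block is the entering face translated by `N·e_μ`): the CHARGE AUDIT of the response σ-letter (the OWNER
  gan24-p1 g25's R11) — its live charge is `Σ_κ Z(S κ ·) ×` this read of the response kernel's COLUMN PROFILE, ZERO when that profile is block-periodic, DISPLAYED by §2 otherwise.
Asserts NO estimate; NEVER «G-an2-4 closed» as (CONV-C); NOT D1, NOT BetaPertH, NOT continuum, NOT Clay.  2026-08-22; no existing file touched.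
-/

noncomputable section

open Finset
open scoped BigOperators
open Literature.MathematicalPhysics.QuantumFieldTheory
open Literature.MathematicalPhysics.QuantumFieldTheory.Balaban1983to89
open Literature.MathematicalPhysics.QuantumFieldTheory.Balaban1983to89.Beta
open B6BondElimination (unitVec unitVec_apply)
open ExpKernelCalculus (Site)
open AffineAveraging (box toSite)
open AveragingContours (blk blk_block)
open AxialProjector (toSite_injective)
open Summit.QuantumFields.BalabanUV.Beta.KernelWardRelative (gaugeWt)
open Summit.QuantumFields.BalabanUV.Beta.GAN24.BlockDivergenceFlux (finsetSum_sub_shift_eq_layers boxSum_sub_shift_eq_faces)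
open Summit.QuantumFields.BalabanUV.Beta.GAN24.GaugeReadLabelSums (sum_read_gaugeWt_eq_boxSum)

namespace Summit.QuantumFields.BalabanUV.Beta.GAN24.GaugeReadLayerForm

variable {d N : ℕ}

/-! ## §1 A label sum of block sums is one sum over the fine union -/

/-- [folklore] **THE BLOCKS OF DISTINCT LABELS ARE DISJOINT, SO A LABEL SUM OF BLOCK SUMS IS ONE SUM OVER THE FINE UNION**:
`Σ_{y∈T} Σ_{v∈box} f (N•y + toSite v) = Σ_{u ∈ T.biUnion (y ↦ (box).image (v ↦ N•y + toSite v))} f u` (`blk_block`: `blk N (N•y + toSite v) = y`; `toSite` injective). -/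
theorem sum_sum_box_eq_sum_biUnion {G : Type*} [AddCommMonoid G] (T : Finset (Site (d + 1))) (f : Site (d + 1) → G) :
    ∑ y ∈ T, ∑ v ∈ box (d + 1) N, f ((N : ℤ) • y + toSite v)
      = ∑ u ∈ T.biUnion (fun y => (box (d + 1) N).image (fun v => (N : ℤ) • y + toSite v)), f u := by
  classical
  rw [Finset.sum_biUnion]
  · refine Finset.sum_congr rfl fun y _ => ?_
    rw [Finset.sum_image (fun v _ w _ h => toSite_injective (add_left_cancel h))]
  · intro y _ y' _ hne
    rw [Function.onFun, Finset.disjoint_left]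
    intro u hu hu'
    obtain ⟨v, hv, rfl⟩ := Finset.mem_image.1 hu
    obtain ⟨v', hv', h⟩ := Finset.mem_image.1 hu'
    exact hne ((blk_block y hv).symm.trans (by rw [← h]; exact blk_block y' hv'))

/-! ## §2 The response read with the union weight, in cancelled layer form -/

/-- [folklore] **THE CANCELLED LAYER FORM OF THE RESPONSE READ** (`1 ≤ N`, any scalar family `g`, every finset `T` of labels; `U` = the fine union of the blocks of `T`):
`∑' x₂, Σ_κ g κ x₂ · (Σ_{y∈T} gaugeWt N y κ x₂) = Σ_κ (Σ_{w ∈ (U − e_κ) ∖ U} g κ w − Σ_{u ∈ U ∖ (U − e_κ)} g κ u)` — `g` on the ENTERING layer minus `g` on the EXITING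
layer of `U`, direction by direction (`GaugeReadLabelSums.sum_read_gaugeWt_eq_boxSum` ⨾ §1 ⨾ leaf-03's `finsetSum_sub_shift_eq_layers`): the interior faces of the block-by-block
form `sum_read_gaugeWt_eq_faceSum` cancel; what (LT-Δ) receives is ONE bounded family read on `∂U` only. -/
theorem sum_read_gaugeWt_eq_layers (hN : 1 ≤ N) (g : Fin (d + 1) → Site (d + 1) → ℝ) (T : Finset (Site (d + 1))) :
    ∑' x₂, ∑ κ₂, g κ₂ x₂ * ∑ y ∈ T, gaugeWt N y κ₂ x₂
      = ∑ κ, (∑ w ∈ (T.biUnion (fun y => (box (d + 1) N).image (fun v => (N : ℤ) • y + toSite v))).image (fun u => u - unitVec κ)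
                  \ T.biUnion (fun y => (box (d + 1) N).image (fun v => (N : ℤ) • y + toSite v)), g κ w
          - ∑ u ∈ T.biUnion (fun y => (box (d + 1) N).image (fun v => (N : ℤ) • y + toSite v))
                  \ (T.biUnion (fun y => (box (d + 1) N).image (fun v => (N : ℤ) • y + toSite v))).image (fun u => u - unitVec κ), g κ u) := by
  classical
  rw [sum_read_gaugeWt_eq_boxSum hN g T]
  have h := sum_sum_box_eq_sum_biUnion (N := N) T (fun u => ∑ κ, (g κ (u - unitVec κ) - g κ u))
  beta_reduce at h
  rw [h, Finset.sum_comm]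
  exact Finset.sum_congr rfl fun κ _ => finsetSum_sub_shift_eq_layers _ (g κ) (unitVec κ)

/-! ## §3 A block-periodic profile has ZERO response read (the charge audit of the response letter, R11) -/

/-- [folklore] On the entering face `v μ = 0`, raising the `μ`-th offset to `N − 1` is the translation by `(N−1)·e_μ` (`1 ≤ N`). -/
theorem toSite_update_top (hN : 1 ≤ N) {v : Fin (d + 1) → ℕ} {μ : Fin (d + 1)} (hv : v μ = 0) :
    toSite (Function.update v μ (N - 1)) = toSite v + ((N : ℤ) - 1) • unitVec μ := by
  funext i
  simp only [toSite, Pi.add_apply, Pi.smul_apply, unitVec_apply, smul_eq_mul]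
  by_cases hi : i = μ
  · subst hi
    rw [Function.update_self, if_pos rfl, hv, Nat.cast_sub hN]
    push_cast
    ring
  · rw [Function.update_of_ne hi, if_neg hi]
    ring

/-- [folklore] **A PROFILE THAT IS `N`-PERIODIC ALONG `μ` HAS EQUAL ENTERING AND EXITING FACE SUMS**, hence ZERO block sum of its backward `μ`-differences:
`Σ_{v ∈ box} (f (N•y + v − e_μ) − f (N•y + v)) = 0` — the exiting face is the entering face translated by `N·e_μ` (leaf-03's `boxSum_sub_shift_eq_faces` + a
face-to-face bijection). -/
theorem boxSum_sub_shift_eq_zero_of_periodic (hN : 1 ≤ N) {f : Site (d + 1) → ℝ} {μ : Fin (d + 1)}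
    (hf : ∀ x, f (x + (N : ℤ) • unitVec μ) = f x) (y : Site (d + 1)) :
    ∑ v ∈ box (d + 1) N, (f ((N : ℤ) • y + toSite v - unitVec μ) - f ((N : ℤ) • y + toSite v)) = 0 := by
  classical
  rw [boxSum_sub_shift_eq_faces hN f y μ, sub_eq_zero]
  refine Finset.sum_nbij' (fun v => Function.update v μ (N - 1)) (fun w => Function.update w μ 0) ?_ ?_ ?_ ?_ ?_
  · intro v hv
    simp only [Finset.mem_filter, AffineAveraging.box, Fintype.mem_piFinset, Finset.mem_range] at hv ⊢
    refine ⟨fun i => ?_, Function.update_self _ _ _⟩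
    by_cases hi : i = μ
    · subst hi; rw [Function.update_self]; omega
    · rw [Function.update_of_ne hi]; exact hv.1 i
  · intro w hw
    simp only [Finset.mem_filter, AffineAveraging.box, Fintype.mem_piFinset, Finset.mem_range] at hw ⊢
    refine ⟨fun i => ?_, Function.update_self _ _ _⟩
    by_cases hi : i = μ
    · subst hi; rw [Function.update_self]; omega
    · rw [Function.update_of_ne hi]; exact hw.1 i
  · intro v hv
    simp only [Finset.mem_filter] at hv
    rw [Function.update_idem, ← hv.2, Function.update_eq_self]
  · intro w hw
    simp only [Finset.mem_filter] at hw
    rw [Function.update_idem, ← hw.2, Function.update_eq_self]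
  · intro v hv
    simp only [Finset.mem_filter] at hv
    rw [toSite_update_top hN hv.2]
    have e : (N : ℤ) • y + (toSite v + ((N : ℤ) - 1) • unitVec μ) = ((N : ℤ) • y + toSite v - unitVec μ) + (N : ℤ) • unitVec μ := by
      rw [sub_smul, one_smul]
      abel
    rw [e, hf]

/-- [folklore] **THE RESPONSE READ OF A BLOCK-PERIODIC PROFILE VANISHES** (`1 ≤ N`, every finset `T` of labels): if `g κ` is `N`-periodic along `κ` for every `κ`
(`g κ (x + N•e_κ) = g κ x` — e.g. a profile depending on `x` only through its position in its block), then `∑' x, Σ_κ g κ x · ĝ_T κ x = 0` — the pairing of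
`∇1_{T-fine}` with an `N`-periodic profile is ZERO for every `T` (block by block the entering and exiting faces carry the same values).  The charge audit of the
response letter (the OWNER gan24-p1 g25's R11): its LIVE CHARGE is `Σ_κ Z(S κ ·)·(this read of the response kernel's COLUMN PROFILE)` — zero exactly when that
profile is block-periodic across `∂(T-fine)`, DISPLAYED by `sum_read_gaugeWt_eq_layers` otherwise. -/
theorem sum_read_gaugeWt_eq_zero_of_periodic (hN : 1 ≤ N) {g : Fin (d + 1) → Site (d + 1) → ℝ}
    (hg : ∀ κ x, g κ (x + (N : ℤ) • unitVec κ) = g κ x) (T : Finset (Site (d + 1))) :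
    ∑' x₂, ∑ κ₂, g κ₂ x₂ * ∑ y ∈ T, gaugeWt N y κ₂ x₂ = 0 := by
  rw [sum_read_gaugeWt_eq_boxSum hN g T]
  refine Finset.sum_eq_zero fun y _ => ?_
  rw [Finset.sum_comm]
  exact Finset.sum_eq_zero fun κ _ => boxSum_sub_shift_eq_zero_of_periodic hN (hg κ) y

end Summit.QuantumFields.BalabanUV.Beta.GAN24.GaugeReadLayerForm

end
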